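import Summits.RiemannHypothesis.RiemannHypothesis.Theses.SpectralTrace
import Literature.NumberTheory.LFunctions.WeilExplicitFormulaProofs

/-!
# Load-bearing analysis of crux `SpectralTrace.WindowTracePrime2` (stmt-RiemannHypothesis-11196)

Negative-side support (cdisprove seat refuter-cdisprove-stmt-RiemannHypothesis-11196-0).

* `windowTracePrime2_false_without_IsWeilTest`: with the hypothesis `IsWeilTest g` dropped the
  crux is FALSE — witness the spike `𝟙_{{0}}` (supported in the window, zero a.e.): every
  `ĝ(1/2+iγ) = 0` while `W(𝟙_{{0}}) = -log π ≠ 0`. Any proof must use the regularity of the tests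
  (the point values `g 0`, `g (±log 2)` enter `W`).
* `hasSum_nontrivialZeros`: UNCONDITIONALLY the non-trivial zeros counted with multiplicity
  (index `Σ ρ, Fin m(ρ)`) satisfy `HasSum (fun i ↦ ĝ(ρ_i)) (W g)` for every Weil test — the tree's
  explicit formula (`explicit_formula_holds`, `summable_norm_zeroSide`) regrouped as one absolutely
  convergent family. So the crux with "`γ` real" weakened to "`ρ` complex" is a theorem: realness
  of the family is the entire content of the crux.
* `not_riemannHypothesis_of_not_windowTracePrime2`: under RH those `ρ_i` are `1/2 + i·Im ρ_i`, so a
  refutation of the crux refutes the Riemann hypothesis — the crux resists every unconditional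
  attack (counterexample search, small models, limiting regimes).
-/

noncomputable section

open Complex Filter Set MeasureTheory
open scoped Real Topology

namespace Summit.RiemannHypothesis.RiemannHypothesis.Theorems.WindowTracePrime2.Negative

open Literature.NumberTheory.LFunctions
open Literature.NumberTheory.LFunctions.ZetaZeros
open Summit.RiemannHypothesis.RiemannHypothesis.Theses.SpectralTrace

/-! ## `IsWeilTest` is load-bearing -/

/-- The spike `𝟙_{{0}}` takes the value `1` at `0`. [folklore] -/
theorem spike_zero : (Set.indicator ({0} : Set ℝ) (fun _ : ℝ => (1 : ℂ))) 0 = 1 := by simp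

/-- The spike `𝟙_{{0}}` vanishes off `0`. [folklore] -/
theorem spike_of_ne {t : ℝ} (ht : t ≠ 0) :
    (Set.indicator ({0} : Set ℝ) (fun _ : ℝ => (1 : ℂ))) t = 0 := by
  simp [ht]

/-- The spike `𝟙_{{0}}` is supported in the window `[-log 3, log 3]` (indeed in `{0}`). [folklore] -/
theorem tsupport_spike :
    tsupport (Set.indicator ({0} : Set ℝ) (fun _ : ℝ => (1 : ℂ))) ⊆
      Set.Icc (-Real.log 3) (Real.log 3) := by
  refine (closure_mono (Set.support_indicator_subset)).trans ?_
  rw [closure_singleton, Set.singleton_subset_iff, Set.mem_Icc]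
  have h : 0 ≤ Real.log 3 := Real.log_nonneg (by norm_num)
  exact ⟨by linarith, h⟩

/-- Every transform `ĝ(s)` of the spike vanishes (the spike is `0` a.e.). [folklore] -/
theorem weilMellin_spike (s : ℂ) :
    weilMellin (Set.indicator ({0} : Set ℝ) (fun _ : ℝ => (1 : ℂ))) s = 0 := by
  unfold weilMellin
  refine integral_eq_zero_of_ae ?_
  have h0 : volume ({0} : Set ℝ) = 0 := measure_singleton 0
  filter_upwards [measure_eq_zero_iff_ae_notMem.1 h0] with t ht
  rw [spike_of_ne ht, zero_mul, Pi.zero_apply]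

/-- The polar term of the (Set.indicator ({0} : Set ℝ) (fun _ : ℝ => (1 : ℂ))) vanishes. [folklore] -/
theorem weilPolarTerm_spike :
    weilPolarTerm (Set.indicator ({0} : Set ℝ) (fun _ : ℝ => (1 : ℂ))) = 0 := by
  simp only [weilPolarTerm, weilMellin_spike, add_zero]

/-- The archimedean term of the spike is `-g(0) log π = -log π`. [folklore] -/
theorem weilArchTerm_spike :
    weilArchTerm (Set.indicator ({0} : Set ℝ) (fun _ : ℝ => (1 : ℂ))) = -(Real.log π : ℂ) := by
  rw [weilArchTerm, weilArchIntegral]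
  simp only [weilMellin_spike, zero_mul, integral_zero, mul_zero, spike_zero, one_mul, zero_sub]

/-- The prime term of the spike vanishes (`Λ(0) = Λ(1) = 0`, `log n ≠ 0` for `n ≥ 2`).
[folklore] -/
theorem weilPrimeTerm_spike :
    weilPrimeTerm (Set.indicator ({0} : Set ℝ) (fun _ : ℝ => (1 : ℂ))) = 0 := by
  unfold weilPrimeTerm
  refine (tsum_congr fun n => ?_).trans tsum_zero
  rcases Nat.lt_or_ge n 2 with hn | hn
  · interval_cases n <;> simp
  · have hn' : (2 : ℝ) ≤ n := by exact_mod_cast hn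
    have hlog : 0 < Real.log n := Real.log_pos (by linarith)
    rw [spike_of_ne hlog.ne', spike_of_ne (by linarith : -Real.log n ≠ 0)]
    simp

/-- `W(𝟙_{{0}}) = -log π`. [folklore] -/
theorem weilFunctional_spike :
    weilFunctional (Set.indicator ({0} : Set ℝ) (fun _ : ℝ => (1 : ℂ))) = -(Real.log π : ℂ) := by
  rw [weilFunctional, weilPolarTerm_spike, weilArchTerm_spike, weilPrimeTerm_spike, sub_zero, zero_add]

/-- **`IsWeilTest` cannot be dropped from `WindowTracePrime2`.** Witness `g = 𝟙_{{0}}`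
(supported in the window, zero a.e.): every `ĝ(1/2+iγ) = 0`, but `W(g) = -g(0) log π = -log π ≠ 0`,
so no family (real or complex) has `HasSum (fun i ↦ ĝ(1/2+iγ_i)) (W g)`. [folklore] -/
theorem windowTracePrime2_false_without_IsWeilTest :
    ¬ ∃ (ι : Type) (γ : ι → ℝ), ∀ g : ℝ → ℂ,
      tsupport g ⊆ Set.Icc (-Real.log 3) (Real.log 3) →
        HasSum (fun i => weilMellin g (1 / 2 + (γ i : ℂ) * Complex.I)) (weilFunctional g) := by
  rintro ⟨ι, γ, h⟩
  have hs := h (Set.indicator ({0} : Set ℝ) (fun _ : ℝ => (1 : ℂ))) tsupport_spike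
  simp only [weilMellin_spike, weilFunctional_spike] at hs
  have h0 : (-(Real.log π : ℂ)) = 0 := hs.unique hasSum_zero
  have hπ : 0 < Real.log π := Real.log_pos (by linarith [Real.pi_gt_three])
  have : (Real.log π : ℂ) = 0 := neg_eq_zero.1 h0
  exact hπ.ne' (by exact_mod_cast this)

/-! ## Realness is load-bearing: the complex trace is unconditional; `¬crux → ¬RH` -/

/-- Multiplicities of non-trivial zeros are non-negative, so `toNat` is faithful. [folklore] -/
theorem order_toNat_cast (ρ : riemannZetaNontrivialZeros) :
    (((riemannZetaZeroOrder (ρ : ℂ)).toNat : ℕ) : ℤ) = riemannZetaZeroOrder (ρ : ℂ) :=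
  Int.toNat_of_nonneg (riemannZetaZeroOrder_nonneg (riemannZetaNontrivialZeros.ne_one ρ.2))

/-- **The explicit formula as an unconditional COMPLEX trace**: over the non-trivial zeros with
multiplicity, `Σ_i ĝ(ρ_i) = W(g)` as an (absolutely convergent) `HasSum`, for every Weil test `g`
(`explicit_formula_holds` + `summable_norm_zeroSide`). [cite: Bombieri2000Weil, §2 Thm. 2] -/
theorem hasSum_nontrivialZeros {g : ℝ → ℂ} (hg : IsWeilTest g) :
    HasSum (fun i : (Σ ρ : riemannZetaNontrivialZeros, Fin (Int.toNat (riemannZetaZeroOrder (ρ : ℂ)))) =>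
      weilMellin g (i.1 : ℂ)) (weilFunctional g) := by
  let ZI : Type := (Σ ρ : riemannZetaNontrivialZeros, Fin (Int.toNat (riemannZetaZeroOrder (ρ : ℂ))))
  have hS := summable_norm_zeroSide hg
  have hnn : ∀ ρ : riemannZetaNontrivialZeros, (0 : ℝ) ≤ riemannZetaZeroOrder (ρ : ℂ) :=
    fun ρ => by exact_mod_cast riemannZetaZeroOrder_nonneg (riemannZetaNontrivialZeros.ne_one ρ.2)
  have hcastR : ∀ ρ : riemannZetaNontrivialZeros,
      (((riemannZetaZeroOrder (ρ : ℂ)).toNat : ℕ) : ℝ) = (riemannZetaZeroOrder (ρ : ℂ) : ℝ) :=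
    fun ρ => by exact_mod_cast order_toNat_cast ρ
  have hcastC : ∀ ρ : riemannZetaNontrivialZeros,
      (((riemannZetaZeroOrder (ρ : ℂ)).toNat : ℕ) : ℂ) = (riemannZetaZeroOrder (ρ : ℂ) : ℂ) :=
    fun ρ => by exact_mod_cast order_toNat_cast ρ
  -- absolute summability over the index with multiplicity
  have h1 : Summable fun i : ZI => ‖weilMellin g (i.1 : ℂ)‖ := by
    refine (summable_sigma_of_nonneg fun _ => norm_nonneg _).2 ⟨fun ρ => ?_, ?_⟩
    · exact (hasSum_fintype _).summable
    · simp only [tsum_fintype, Finset.sum_const, Finset.card_univ, Fintype.card_fin,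
        nsmul_eq_mul]
      refine hS.congr fun ρ => ?_
      rw [norm_mul, Complex.norm_intCast, abs_of_nonneg (hnn ρ), hcastR]
  have h2 : HasSum (fun i : ZI => weilMellin g (i.1 : ℂ)) (∑' i : ZI, weilMellin g (i.1 : ℂ)) :=
    h1.of_norm.hasSum
  -- regroup fibrewise: `Σ_ρ m(ρ) ĝ(ρ)` has the same sum
  have h3 : HasSum (fun ρ : riemannZetaNontrivialZeros =>
      (riemannZetaZeroOrder (ρ : ℂ) : ℂ) * weilMellin g ρ) (∑' i : ZI, weilMellin g (i.1 : ℂ)) := by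
    refine (h2.sigma fun ρ => hasSum_fintype _).congr_fun fun ρ => ?_
    simp only [Finset.sum_const, Finset.card_univ, Fintype.card_fin, nsmul_eq_mul, hcastC]
  -- and that sum is `W(g)` by the explicit formula (uniqueness of the symmetric limit)
  have hZ : HasWeilZeroSide g
      (∑' ρ : riemannZetaNontrivialZeros, (riemannZetaZeroOrder (ρ : ℂ) : ℂ) * weilMellin g ρ) :=
    hasWeilZeroSide_tsum hS
  have hZW := tendsto_nhds_unique hZ (explicit_formula_holds hg)
  have hS' : (∑' i : ZI, weilMellin g (i.1 : ℂ)) = weilFunctional g := by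
    rw [← h3.tsum_eq]; exact hZW
  exact hS' ▸ h2

/-- **RESISTANCE**: a refutation of the crux refutes RH. Under RH every non-trivial zero is
`1/2 + i·Im ρ`, so the ordinates with multiplicity realise every window
(`hasSum_nontrivialZeros`). [folklore] -/
theorem not_riemannHypothesis_of_not_windowTracePrime2 (h : ¬ WindowTracePrime2) :
    ¬ _root_.RiemannHypothesis := by
  intro hRH
  refine h ⟨(Σ ρ : riemannZetaNontrivialZeros, Fin (Int.toNat (riemannZetaZeroOrder (ρ : ℂ)))),
    fun i => (i.1 : ℂ).im, fun g hg _ => ?_⟩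
  have heq : ∀ i : (Σ ρ : riemannZetaNontrivialZeros, Fin (Int.toNat (riemannZetaZeroOrder (ρ : ℂ)))),
      (1 / 2 : ℂ) + (((i.1 : ℂ).im : ℝ) : ℂ) * Complex.I = (i.1 : ℂ) := by
    rintro ⟨⟨ρ, hρ⟩, k⟩
    have hre : ρ.re = 1 / 2 := by
      refine hRH ρ (riemannZetaNontrivialZeros.zeta_eq_zero hρ) ?_
        (riemannZetaNontrivialZeros.ne_one hρ)
      rintro ⟨n, rfl⟩
      have h := riemannZetaNontrivialZeros.re_pos hρ
      simp at h
      linarith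
    apply Complex.ext <;> simp [hre]
  simpa only [heq] using hasSum_nontrivialZeros hg

end Summit.RiemannHypothesis.RiemannHypothesis.Theorems.WindowTracePrime2.Negative

end
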